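import Mathlib
import HarnessLib
import Literature.Analysis.FluidPDE.TypeIAncientMild
import Literature.Analysis.FluidPDE.VorticityCalculus
import Literature.Analysis.FluidPDE.CurlFreeLiouville
import Literature.Analysis.FluidPDE.TsaiSelfSimilarBounded
import Literature.Analysis.FluidPDE.FirstIntegralTransportDefect
import Literature.Analysis.FluidPDE.BarkerPrange2020VorticityAlignmentTypeIHolds
import Summits.NavierStokesRegularity.NavierStokesRegularity.Theorems.PoloidalWindowDoorPoloidalWindowRigidityWindow
import Summits.NavierStokesRegularity.NavierStokesRegularity.Theorems.PoloidalWindowDoorPoloidalWindowRigidityLoopTangencyPin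

/-!
# Route `PoloidalWindowDoor`, crux `PoloidalWindowRigidity` (K2, stmt-NavierStokesRegularity-19708) — LINE 14 `loop_island`
# (ns-idea-8 g7, lens «barrier»), STUB Y `stub_layeredNoLoop`: a `v₂`-FLAT SLAB makes the slice LAYERED, and layered slices carry no loops

Cell ns-regularity-ideate, seat ns-poloidal-K2-p2 g12 (stub-worker on K2; `--supports` the crux item).  Statement VERBATIM
`Cruxes/PoloidalWindowRigidity/Lines/loop_island.lean` (ad8f96e88fc9) l.193–207.

Setting: a profile of the route's Type-I class, e₃-poloidal at all times, a time `s < 0` at which `v₂(s,·)` is constant on every horizontal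
plane of a slab `|z − z₀| < δ`; CONCLUSION: every periodic orbit of `curl v(s)` is stationary (`curl v(s) (γ 0) = 0`).

PROOF.  (1) `w := v₂(s,·)` is HORIZONTALLY INVARIANT on all of `ℝ³` (`horizInvariant_of_slab`): for a horizontal `h`, `y ↦ w(y+h) − w(y)` is
real-analytic (tree `IsTypeIAncientMild.analyticOnNhd_slice_univ`) and vanishes on the open slab, hence everywhere (identity theorem); so
`∂₀w = ∂₁w = 0` (`fderiv_eq_zero_of_horizInvariant`).  (2) LAYERING (`sum_second_horiz_eq_zero`, `planar_harmonic_const`): with `ω₂ = ∂₀v₁ − ∂₁v₀ = 0`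
(poloidal), `div v = 0` and `∂₀w = ∂₁w = 0`, each horizontal component satisfies `∂₀∂₀vᵢ + ∂₁∂₁vᵢ = ∂ᵢ(∂₀v₀ + ∂₁v₁) = −∂ᵢ∂₂w = −∂₂∂ᵢw = 0`
(symmetry of second derivatives), so `a ↦ vᵢ(a₀, a₁, z)` is a bounded (Type-I rate) harmonic function on `ℝ²`, constant by Liouville
(tree `isConst_of_harmonic_bounded`); hence the whole slice is horizontally invariant, and so are `Dv(s)` and `curl v(s) = curlCLM ∘ Dv(s)`.
(3) STRAIGHT ORBITS: the orbit is planar (`(curl v(s))₂ = 0`, `…LoopTangencyPin.apply_integralCurve_eq`), so `curl v(s)` is constant `= κ` along it,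
`θ ↦ γ θ − θκ` has zero derivative, and `γ ℓ = γ 0` forces `ℓκ = 0`, i.e. `κ = 0`.  The class bounds (boundedness on all of `ℝ³`) and analyticity
are used essentially — honours I8c (false for unbounded columns).

WHAT THIS IS NOT: not a claim about Navier–Stokes regularity — one provable stub of an ideator line of a door route (bears_on LADDER-NS N0,
rung N0-LocalTubeDoorPoloidal); stubs J (Jordan), Z (persistence) and the residues S0 / HL3′ / NoIslands are not touched; crux 19708 and items
20428 / 27893 / 22881 stay OPEN.
-/

noncomputable section

-- the summit and its single sub-problem share the name (CONVENTIONS §1), as in every Theorems file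
set_option linter.dupNamespace false

namespace Summit.NavierStokesRegularity.NavierStokesRegularity.Theorems.PoloidalWindowDoorPoloidalWindowRigidityLayeredNoLoop

open MeasureTheory Set Function Filter Topology Metric InnerProductSpace
open scoped RealInnerProductSpace InnerProductSpace Laplacian
open Literature.Analysis Literature.Analysis.FluidPDE
open Summit.NavierStokesRegularity.NavierStokesRegularity.Theorems.PoloidalWindowDoorPoloidalWindowRigidityWindow
open Summit.NavierStokesRegularity.NavierStokesRegularity.Theorems.PoloidalWindowDoorPoloidalWindowRigidityLoopTangencyPin

/-! ### (1) Horizontal invariance from a flat slab -/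

/-- **A real-analytic function on `ℝ³` that is constant on every horizontal plane of a slab is horizontally invariant on all of `ℝ³`**
(identity theorem applied to `y ↦ f (y + h) − f y`, `h` horizontal). [folklore] -/
theorem horizInvariant_of_slab {f : EuclideanSpace ℝ (Fin 3) → ℝ} (hf : AnalyticOnNhd ℝ f univ) {z₀ δ : ℝ} (hδ : 0 < δ)
    (hflat : ∀ z : ℝ, |z - z₀| < δ → ∃ c : ℝ, ∀ y : EuclideanSpace ℝ (Fin 3), y 2 = z → f y = c)
    (y h : EuclideanSpace ℝ (Fin 3)) (hh : h 2 = 0) : f (y + h) = f y := by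
  set F : EuclideanSpace ℝ (Fin 3) → ℝ := fun y => f (y + h) - f y with hF
  have hFan : AnalyticOnNhd ℝ F univ := by
    intro y _
    have h1 : AnalyticAt ℝ (fun y => f (y + h)) y :=
      (hf (y + h) (mem_univ _)).comp (f := fun y => y + h) (analyticAt_id.add analyticAt_const)
    exact h1.sub (hf y (mem_univ _))
  -- `F` vanishes on the open slab
  set S : Set (EuclideanSpace ℝ (Fin 3)) := {y | |y 2 - z₀| < δ} with hS
  have hSo : IsOpen S :=
    isOpen_lt (continuous_abs.comp ((EuclideanSpace.proj (𝕜 := ℝ) (2 : Fin 3)).continuous.sub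
      continuous_const)) continuous_const
  have hy₀S : EuclideanSpace.single (2 : Fin 3) z₀ ∈ S := by
    show |EuclideanSpace.single (2 : Fin 3) z₀ 2 - z₀| < δ
    simpa using hδ
  have hFS : ∀ y ∈ S, F y = 0 := by
    intro y hy
    obtain ⟨c, hc⟩ := hflat (y 2) hy
    have h1 : f (y + h) = c := hc (y + h) (by simp [hh])
    have h2 : f y = c := hc y rfl
    simp [hF, h1, h2]
  have hEv : F =ᶠ[𝓝 (EuclideanSpace.single (2 : Fin 3) z₀)] 0 := by
    filter_upwards [hSo.mem_nhds hy₀S] with y hy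
    exact hFS y hy
  have hzero := hFan.eqOn_zero_of_preconnected_of_eventuallyEq_zero isPreconnected_univ (mem_univ _) hEv
  have := hzero (mem_univ y)
  simp only [hF, Pi.zero_apply, sub_eq_zero] at this
  exact this

/-- A horizontally invariant differentiable function has vanishing horizontal derivatives. [folklore] -/
theorem fderiv_eq_zero_of_horizInvariant {f : EuclideanSpace ℝ (Fin 3) → ℝ} (hf : Differentiable ℝ f)
    (hinv : ∀ y h : EuclideanSpace ℝ (Fin 3), h 2 = 0 → f (y + h) = f y)
    (y h : EuclideanSpace ℝ (Fin 3)) (hh : h 2 = 0) : fderiv ℝ f y h = 0 := by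
  -- the line `t ↦ y + t h` and `f` restricted to it
  have hline : HasDerivAt (fun t : ℝ => y + t • h) h 0 := by
    simpa using ((hasDerivAt_id (0 : ℝ)).smul_const h).const_add y
  have hcomp : HasDerivAt (fun t : ℝ => f (y + t • h)) (fderiv ℝ f y h) 0 := by
    have h1 : HasFDerivAt f (fderiv ℝ f y) (y + (0 : ℝ) • h) := by
      rw [zero_smul, add_zero]; exact (hf y).hasFDerivAt
    exact h1.comp_hasDerivAt (0 : ℝ) hline
  have hconst : (fun t : ℝ => f (y + t • h)) = fun _ => f y := by
    funext t
    exact hinv y (t • h) (by simp [hh])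
  rw [hconst] at hcomp
  exact hcomp.unique (hasDerivAt_const 0 (f y)) ▸ rfl

/-! ### (2) Planar harmonicity of the horizontal components -/

/-- Coordinates of second derivatives: `D²(y ↦ V y i)(x) k h = (D²V(x) k h)ᵢ` for `V ∈ C²`. [folklore] -/
theorem fderiv_fderiv_coord {V : EuclideanSpace ℝ (Fin 3) → EuclideanSpace ℝ (Fin 3)} (hV : ContDiff ℝ 2 V)
    (x k h : EuclideanSpace ℝ (Fin 3)) (i : Fin 3) :
    fderiv ℝ (fderiv ℝ (fun y => V y i)) x k h = fderiv ℝ (fderiv ℝ V) x k h i := by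
  have hd : DifferentiableAt ℝ (fderiv ℝ V) x :=
    ((hV.fderiv_right (m := 1) le_rfl).differentiable one_ne_zero) x
  have hVd : Differentiable ℝ V := hV.differentiable two_ne_zero
  -- `D(y ↦ V y i) = proj i ∘L DV`
  have e1 : fderiv ℝ (fun y => V y i) = fun y => (EuclideanSpace.proj (𝕜 := ℝ) i).comp (fderiv ℝ V y) := by
    funext y
    exact ((EuclideanSpace.proj (𝕜 := ℝ) i).hasFDerivAt.comp y (hVd y).hasFDerivAt).fderiv
  rw [e1]
  have e2 : HasFDerivAt (fun y => (EuclideanSpace.proj (𝕜 := ℝ) i).comp (fderiv ℝ V y))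
      (((ContinuousLinearMap.compL ℝ (EuclideanSpace ℝ (Fin 3)) (EuclideanSpace ℝ (Fin 3)) ℝ)
        (EuclideanSpace.proj (𝕜 := ℝ) i)).comp (fderiv ℝ (fderiv ℝ V) x)) x :=
    ((ContinuousLinearMap.compL ℝ (EuclideanSpace ℝ (Fin 3)) (EuclideanSpace ℝ (Fin 3)) ℝ)
      (EuclideanSpace.proj (𝕜 := ℝ) i)).hasFDerivAt.comp x hd.hasFDerivAt
  rw [e2.fderiv]
  rfl

/-- **The planar Laplacian of the horizontal components vanishes**: for `V ∈ C²(ℝ³; ℝ³)` with `(curl V)₂ = 0` (`∂₀V₁ = ∂₁V₀`), `div V = 0`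
and `∂₀V₂ = ∂₁V₂ = 0`, one has `∂₀∂₀Vᵢ + ∂₁∂₁Vᵢ = 0` for `i = 0, 1`. [folklore] -/
theorem sum_second_horiz_eq_zero {V : EuclideanSpace ℝ (Fin 3) → EuclideanSpace ℝ (Fin 3)} (hV : ContDiff ℝ 2 V)
    (hsym : ∀ y, fderiv ℝ V y (EuclideanSpace.single 0 1) 1 = fderiv ℝ V y (EuclideanSpace.single 1 1) 0)
    (hdiv : VectorCalculus.IsDivFree V)
    (hw0 : ∀ y, fderiv ℝ V y (EuclideanSpace.single 0 1) 2 = 0) (hw1 : ∀ y, fderiv ℝ V y (EuclideanSpace.single 1 1) 2 = 0)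
    (x : EuclideanSpace ℝ (Fin 3)) (i : Fin 3) (hi : i ≠ 2) :
    fderiv ℝ (fderiv ℝ V) x (EuclideanSpace.single 0 1) (EuclideanSpace.single 0 1) i +
      fderiv ℝ (fderiv ℝ V) x (EuclideanSpace.single 1 1) (EuclideanSpace.single 1 1) i = 0 := by
  set T : EuclideanSpace ℝ (Fin 3) →L[ℝ] EuclideanSpace ℝ (Fin 3) →L[ℝ] EuclideanSpace ℝ (Fin 3) := fderiv ℝ (fderiv ℝ V) x
    with hT
  set E0 : EuclideanSpace ℝ (Fin 3) := EuclideanSpace.single 0 1 with hE0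
  set E1 : EuclideanSpace ℝ (Fin 3) := EuclideanSpace.single 1 1 with hE1
  set E2 : EuclideanSpace ℝ (Fin 3) := EuclideanSpace.single 2 1 with hE2
  -- symmetry of the second derivative
  have hT2 : ∀ h k : EuclideanSpace ℝ (Fin 3), T h k = T k h := fun h k =>
    (hV.contDiffAt.isSymmSndFDerivAt (by simp)) h k
  -- the mixed relation from `ω₂ = 0`
  have hmix : ∀ k, T k E1 0 = T k E0 1 := by
    intro k
    rw [hT, ← fderiv_fderiv_apply_coord hV x E1 k 0, ← fderiv_fderiv_apply_coord hV x E0 k 1]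
    have e : (fun y => fderiv ℝ V y E1 0) = fun y => fderiv ℝ V y E0 1 := funext fun y => (hsym y).symm
    rw [e]
  -- the derivatives of `∂₀V₂ ≡ 0`, `∂₁V₂ ≡ 0` vanish
  have hz0 : ∀ k, T k E0 2 = 0 := by
    intro k
    rw [hT, ← fderiv_fderiv_apply_coord hV x E0 k 2]
    have e : (fun y => fderiv ℝ V y E0 2) = fun _ => (0 : ℝ) := funext fun y => hw0 y
    rw [e]; simp
  have hz1 : ∀ k, T k E1 2 = 0 := by
    intro k
    rw [hT, ← fderiv_fderiv_apply_coord hV x E1 k 2]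
    have e : (fun y => fderiv ℝ V y E1 2) = fun _ => (0 : ℝ) := funext fun y => hw1 y
    rw [e]; simp
  -- the derivative of the divergence vanishes: `Σⱼ T k Eⱼ j = 0`
  have hdiv' : ∀ k : EuclideanSpace ℝ (Fin 3), T k E0 0 + T k E1 1 + T k E2 2 = 0 := by
    intro k
    have hzero : (fun y => ∑ j, fderiv ℝ V y (EuclideanSpace.single j (1 : ℝ)) j) = fun _ => (0 : ℝ) := by
      funext y
      have := hdiv y
      rw [VectorCalculus.divergence, trace_eq_sum_coord] at this
      exact this
    have hdj : ∀ j : Fin 3, DifferentiableAt ℝ (fun y => fderiv ℝ V y (EuclideanSpace.single j (1 : ℝ)) j) x := by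
      intro j
      have hd : DifferentiableAt ℝ (fderiv ℝ V) x :=
        ((hV.fderiv_right (m := 1) le_rfl).differentiable one_ne_zero) x
      have hdh : DifferentiableAt ℝ (fun y => fderiv ℝ V y (EuclideanSpace.single j (1 : ℝ))) x :=
        hd.clm_apply (differentiableAt_const _)
      have e1 : (fun y => fderiv ℝ V y (EuclideanSpace.single j (1 : ℝ)) j) =
          (EuclideanSpace.proj j : EuclideanSpace ℝ (Fin 3) →L[ℝ] ℝ) ∘ fun y => fderiv ℝ V y (EuclideanSpace.single j (1 : ℝ)) := by
        funext y; rfl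
      rw [e1]
      exact (EuclideanSpace.proj j : EuclideanSpace ℝ (Fin 3) →L[ℝ] ℝ).differentiableAt.comp x hdh
    have h1 : fderiv ℝ (fun y => ∑ j, fderiv ℝ V y (EuclideanSpace.single j (1 : ℝ)) j) x k =
        ∑ j, T k (EuclideanSpace.single j (1 : ℝ)) j := by
      rw [fderiv_fun_sum fun j _ => hdj j, _root_.sum_apply]
      exact Finset.sum_congr rfl fun j _ => fderiv_fderiv_apply_coord hV x _ _ j
    have h2 : ∑ j, T k (EuclideanSpace.single j (1 : ℝ)) j = 0 := by
      rw [← h1, hzero]; simp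
    simpa [Fin.sum_univ_three, hE0, hE1, hE2] using h2
  fin_cases i
  · -- i = 0: T E0 E0 0 + T E1 E1 0 = T E0 E0 0 + T E0 E1 1 = -T E0 E2 2 = -T E2 E0 2 = 0
    have h1 : T E1 E1 0 = T E0 E1 1 := by rw [hmix E1, hT2 E1 E0]
    have h2 := hdiv' E0
    have h3 : T E0 E2 2 = 0 := by rw [hT2 E0 E2]; exact hz0 E2
    simp only [Fin.zero_eta, Fin.isValue]
    linarith
  · -- i = 1: T E0 E0 1 + T E1 E1 1 = T E1 E0 0 + T E1 E1 1 = -T E1 E2 2 = 0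
    have h1 : T E0 E0 1 = T E1 E0 0 := by rw [← hmix E0, hT2 E0 E1]
    have h2 := hdiv' E1
    have h3 : T E1 E2 2 = 0 := by rw [hT2 E1 E2]; exact hz1 E2
    simp only [Fin.mk_one, Fin.isValue]
    linarith
  · exact absurd rfl hi

/-- **Liouville on horizontal planes**: under the hypotheses of `sum_second_horiz_eq_zero` and a global bound on `V`, each horizontal component
`Vᵢ` (`i = 0, 1`) is constant on every horizontal plane (`a ↦ Vᵢ(a₀, a₁, z)` is a bounded harmonic function on `ℝ²`; tree
`isConst_of_harmonic_bounded`). [folklore] -/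
theorem planar_const_of_layered {V : EuclideanSpace ℝ (Fin 3) → EuclideanSpace ℝ (Fin 3)} (hV : ContDiff ℝ 2 V)
    (hsym : ∀ y, fderiv ℝ V y (EuclideanSpace.single 0 1) 1 = fderiv ℝ V y (EuclideanSpace.single 1 1) 0)
    (hdiv : VectorCalculus.IsDivFree V)
    (hw0 : ∀ y, fderiv ℝ V y (EuclideanSpace.single 0 1) 2 = 0) (hw1 : ∀ y, fderiv ℝ V y (EuclideanSpace.single 1 1) 2 = 0)
    {B : ℝ} (hB : ∀ y, ‖V y‖ ≤ B) (i : Fin 3) (hi : i ≠ 2)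
    (y y' : EuclideanSpace ℝ (Fin 3)) (hyy' : y 2 = y' 2) : V y i = V y' i := by
  set z : ℝ := y 2 with hz
  -- the affine chart of the plane `{y₂ = z}`
  let L : EuclideanSpace ℝ (Fin 2) →L[ℝ] EuclideanSpace ℝ (Fin 3) :=
    (EuclideanSpace.proj (𝕜 := ℝ) (0 : Fin 2)).smulRight (EuclideanSpace.single 0 1) +
      (EuclideanSpace.proj (𝕜 := ℝ) (1 : Fin 2)).smulRight (EuclideanSpace.single 1 1)
  set c₀ : EuclideanSpace ℝ (Fin 3) := EuclideanSpace.single 2 z with hc₀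
  have hL0 : L (EuclideanSpace.single 0 1) = EuclideanSpace.single 0 1 := by
    ext j; fin_cases j <;> simp [L]
  have hL1 : L (EuclideanSpace.single 1 1) = EuclideanSpace.single 1 1 := by
    ext j; fin_cases j <;> simp [L]
  have hchart : ∀ x : EuclideanSpace ℝ (Fin 3), x 2 = z →
      L (EuclideanSpace.single 0 (x 0) + EuclideanSpace.single 1 (x 1)) + c₀ = x := by
    intro x hx
    ext j
    fin_cases j <;> simp [L, hc₀, hx]
  -- the planar function `η a = Vᵢ (L a + c₀)`
  set g : EuclideanSpace ℝ (Fin 3) → ℝ := fun x => V x i with hg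
  have hg2 : ContDiff ℝ 2 g := contDiff_apply_coord_vec3 hV i
  set gs : EuclideanSpace ℝ (Fin 3) → ℝ := fun x => g (x + c₀) with hgs
  have hgs2 : ContDiff ℝ 2 gs := hg2.comp (contDiff_id.add contDiff_const)
  set η : EuclideanSpace ℝ (Fin 2) → ℝ := gs ∘ L with hη
  have hη2 : ContDiff ℝ 2 η := hgs2.comp L.contDiff
  -- its Laplacian vanishes
  have hΔ : ∀ a, (Δ η) a = 0 := by
    intro a
    rw [laplacian_eq_iteratedFDeriv_orthonormalBasis η (EuclideanSpace.basisFun (Fin 2) ℝ)]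
    simp only [Fin.sum_univ_two, EuclideanSpace.basisFun_apply]
    rw [hη, L.iteratedFDeriv_comp_right hgs2 a le_rfl]
    simp only [ContinuousMultilinearMap.compContinuousLinearMap_apply]
    have e : ∀ u : EuclideanSpace ℝ (Fin 2), (fun k : Fin 2 => L (![u, u] k)) = ![L u, L u] := by
      intro u; funext k; fin_cases k <;> rfl
    rw [e (EuclideanSpace.single 0 1), e (EuclideanSpace.single 1 1), hL0, hL1, hgs,
      iteratedFDeriv_comp_add_right 2 c₀ (L a), iteratedFDeriv_two_apply, iteratedFDeriv_two_apply]
    simp only [Matrix.cons_val_zero, Matrix.cons_val_one, Matrix.cons_val_fin_one]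
    rw [hg, fderiv_fderiv_coord hV, fderiv_fderiv_coord hV]
    exact sum_second_horiz_eq_zero hV hsym hdiv hw0 hw1 (L a + c₀) i hi
  have hharm : HarmonicOnNhd η univ := harmonicOnNhd_of_laplacian_eq_zero hη2 hΔ
  have hbdd : ∃ B', ∀ a, |η a| ≤ B' := ⟨B, fun a => by
    have h1 : |V (L a + c₀) i| ≤ ‖V (L a + c₀)‖ := by
      simpa [Real.norm_eq_abs] using PiLp.norm_apply_le (V (L a + c₀)) i
    exact h1.trans (hB _)⟩
  -- Liouville
  have hconst := isConst_of_harmonic_bounded hharm hbdd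
    (EuclideanSpace.single 0 (y 0) + EuclideanSpace.single 1 (y 1))
    (EuclideanSpace.single 0 (y' 0) + EuclideanSpace.single 1 (y' 1))
  simp only [hη, hgs, hg, comp_apply] at hconst
  rwa [hchart y rfl, hchart y' hyy'.symm] at hconst

/-! ### (3) The stub -/

/-- **STUB Y `stub_layeredNoLoop` of LINE 14 `loop_island` (VERBATIM): a `v₂`-flat slab makes the slice layered, and layered slices carry
no loops.**  See the module docstring for the proof. -/
theorem stub_layeredNoLoop :
    ∀ (C : ℝ) (v : ℝ → EuclideanSpace ℝ (Fin 3) → EuclideanSpace ℝ (Fin 3)),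
      Literature.Analysis.FluidPDE.HasTypeITimeDecay C v →
      ContinuousOn (Function.uncurry v) (Set.Iio (0 : ℝ) ×ˢ Set.univ) →
      (∀ s t : ℝ, s < t → t < 0 → ∀ x, v t x =
        Literature.Analysis.UnboundedOperators.heatExtension (v s) (t - s) x -
          Literature.Analysis.FluidPDE.oseenDuhamel 1 s v v t x) →
      (∀ t < 0, Literature.Analysis.FluidPDE.VectorCalculus.IsDivFree (v t)) →
      (∀ s < 0, ∀ y, ⟪Literature.Analysis.FluidPDE.curl (v s) y, EuclideanSpace.single 2 1⟫_ℝ = 0) →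
      ∀ s : ℝ, s < 0 →
        (∃ z₀ δ : ℝ, 0 < δ ∧ ∀ z : ℝ, |z - z₀| < δ → ∃ c : ℝ, ∀ y : EuclideanSpace ℝ (Fin 3), y 2 = z → v s y 2 = c) →
        ∀ (γ : ℝ → EuclideanSpace ℝ (Fin 3)) (ℓ : ℝ), 0 < ℓ →
          (∀ θ, HasDerivAt γ (Literature.Analysis.FluidPDE.curl (v s) (γ θ)) θ) → (∀ θ, γ (θ + ℓ) = γ θ) →
          Literature.Analysis.FluidPDE.curl (v s) (γ 0) = 0 := by
  intro C v hrate hcont hmild hdiv hpol s hs hslab γ ℓ hℓ hγ hper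
  obtain ⟨z₀, δ, hδ, hflat⟩ := hslab
  -- smoothness, analyticity and boundedness of the slice `V := v s`
  have hA : IsTypeIAncientMild C v := isTypeIAncientMild_of_class hrate hcont hmild hdiv
  have hvs : ContDiff ℝ (⊤ : ℕ∞) (v s) := hA.contDiff_slice hs
  have hV2 : ContDiff ℝ 2 (v s) := contDiff_infty.1 hvs 2
  have hVd : Differentiable ℝ (v s) := hV2.differentiable two_ne_zero
  have hwan : AnalyticOnNhd ℝ (fun y => v s y 2) univ := fun y _ =>
    ((EuclideanSpace.proj (𝕜 := ℝ) (2 : Fin 3)).analyticAt _).comp (hA.analyticOnNhd_slice_univ hs y (mem_univ _))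
  have hB : ∀ y, ‖v s y‖ ≤ C / Real.sqrt (-s) := fun y => hrate s hs y
  -- poloidality in coordinates: `∂₀v₁ = ∂₁v₀`
  have hpol1 : ∀ y, curl (v s) y 2 = 0 := fun y => by
    have h := hpol s hs y
    simpa [EuclideanSpace.inner_single_right] using h
  have hsym : ∀ y, fderiv ℝ (v s) y (EuclideanSpace.single 0 1) 1 = fderiv ℝ (v s) y (EuclideanSpace.single 1 1) 0 := by
    intro y
    have h := hpol1 y
    simp only [curl, Fin.isValue, Matrix.cons_val_two, Matrix.tail_cons, Matrix.head_cons, sub_eq_zero] at h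
    simpa [curl, sub_eq_zero] using h
  -- (1) `v₂(s,·)` is horizontally invariant; its horizontal derivatives vanish
  have hwinv : ∀ y h : EuclideanSpace ℝ (Fin 3), h 2 = 0 → v s (y + h) 2 = v s y 2 :=
    fun y h hh => horizInvariant_of_slab hwan hδ hflat y h hh
  have hwd : Differentiable ℝ (fun y => v s y 2) := (contDiff_apply_coord_vec3 hV2 2).differentiable two_ne_zero
  have hw0 : ∀ y, fderiv ℝ (v s) y (EuclideanSpace.single 0 1) 2 = 0 := fun y => by
    rw [← fderiv_apply_coord_vec3 (hVd y) 2]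
    exact fderiv_eq_zero_of_horizInvariant hwd hwinv y _ (by simp)
  have hw1 : ∀ y, fderiv ℝ (v s) y (EuclideanSpace.single 1 1) 2 = 0 := fun y => by
    rw [← fderiv_apply_coord_vec3 (hVd y) 2]
    exact fderiv_eq_zero_of_horizInvariant hwd hwinv y _ (by simp)
  -- (2) the slice is horizontally invariant
  have hinv : ∀ y h : EuclideanSpace ℝ (Fin 3), h 2 = 0 → v s (y + h) = v s y := by
    intro y h hh
    have hplane : (y + h) 2 = y 2 := by simp [hh]
    ext i
    by_cases hi : i = 2
    · subst hi; exact hwinv y h hh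
    · exact planar_const_of_layered hV2 hsym (hdiv s hs) hw0 hw1 hB i hi (y + h) y hplane
  have hDinv : ∀ y h : EuclideanSpace ℝ (Fin 3), h 2 = 0 → fderiv ℝ (v s) (y + h) = fderiv ℝ (v s) y := by
    intro y h hh
    have e : (fun x => v s (x + h)) = v s := funext fun x => hinv x h hh
    rw [← fderiv_comp_add_right, e]
  have hcurlinv : ∀ y h : EuclideanSpace ℝ (Fin 3), h 2 = 0 → curl (v s) (y + h) = curl (v s) y := by
    intro y h hh
    rw [curl_eq_curlCLM, curl_eq_curlCLM, hDinv y h hh]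
  -- (3) the orbit is planar, the field is constant along it, the orbit is a straight line
  have hγ2 : ∀ θ, γ θ 2 = γ 0 2 := fun θ => by
    have hγI : ∀ t ∈ Ioo (-(|θ| + 1)) (|θ| + 1), HasDerivAt γ (curl (v s) (γ t)) t := fun t _ => hγ t
    have hθI : θ ∈ Ioo (-(|θ| + 1)) (|θ| + 1) := ⟨by linarith [neg_abs_le θ], by linarith [le_abs_self θ]⟩
    have hφ : Differentiable ℝ (⇑(EuclideanSpace.proj (𝕜 := ℝ) (2 : Fin 3))) :=
      (EuclideanSpace.proj (𝕜 := ℝ) (2 : Fin 3)).differentiable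
    have hφX : ∀ y, fderiv ℝ (⇑(EuclideanSpace.proj (𝕜 := ℝ) (2 : Fin 3))) y (curl (v s) y) = 0 := fun y => by
      rw [(EuclideanSpace.proj (𝕜 := ℝ) (2 : Fin 3)).fderiv]
      simpa using hpol1 y
    have h := apply_integralCurve_eq hγI hφ hφX hθI
    simpa using h
  set κ : EuclideanSpace ℝ (Fin 3) := curl (v s) (γ 0) with hκ
  have hXγ : ∀ θ, curl (v s) (γ θ) = κ := fun θ => by
    have e : γ θ = γ 0 + (γ θ - γ 0) := by abel
    rw [e, hcurlinv (γ 0) (γ θ - γ 0) (by simp [hγ2 θ])]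
  have hlin : ∀ θ, HasDerivAt (fun θ => γ θ - θ • κ) 0 θ := fun θ => by
    have h1 : HasDerivAt γ κ θ := hXγ θ ▸ hγ θ
    have h2 : HasDerivAt (fun θ : ℝ => θ • κ) κ θ := by simpa using (hasDerivAt_id θ).smul_const κ
    exact (h1.sub h2).congr_deriv (sub_self κ)
  have hconst := is_const_of_deriv_eq_zero (fun θ => (hlin θ).differentiableAt) (fun θ => (hlin θ).deriv) ℓ 0
  have hγℓ : γ ℓ = γ 0 := by simpa using hper 0
  simp only [zero_smul, sub_zero, hγℓ] at hconst
  have : ℓ • κ = 0 := by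
    have := congrArg (fun x => γ 0 - x) hconst
    simpa using this
  exact (smul_eq_zero.1 this).resolve_left hℓ.ne'

end Summit.NavierStokesRegularity.NavierStokesRegularity.Theorems.PoloidalWindowDoorPoloidalWindowRigidityLayeredNoLoop
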